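import Literature.Analysis.Complex.PerronDirichletSeries
import HarnessLib

/-!
# Perron's formula of order two with a purely imaginary shift of the double pole

Trunk: Analysis / Complex (contour integration), continuing `PerronDirichletSeries.lean`.
For a Dirichlet series `F(w) = ∑_n a_n n^{−w}` with `∑ ‖a_n‖/n² < ∞`, a real `x > 0` and a REAL
`b`, on the line `s = 1 + it`:

  `∫_{−∞}^{∞} F(1+s) x^s (s + ib)^{−2} dt = 2π ∑_{1 ≤ n ≤ x} (a_n/n) (x/n)^{−ib} log(x/n)`,

i.e. `(1/2πi) ∫_(1) F(1+s) x^s ds/(s + ib)² = ∑_{n ≤ x} (a_n/n)(x/n)^{−ib} log(x/n)`. This is the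
shape in which order-two Perron kernels `x^s/(s ± β)²` with purely imaginary `β` occur in
Y. Zhang, arXiv:2211.02515v1, §8 (proofs of Lemmas 8.2 and 8.4, display (8.9)), §12 and
Appendix B; the unshifted case `b = 0` is Montgomery–Vaughan (5.22) with `m = 1`
(`Literature.Analysis.Complex.integral_dirichletSeries_mul_perronPow`). Everything here is PROVED:

* `Literature.Analysis.Complex.integral_dirichletSeries_mul_perronSq_shift` — the displayed identity.

## Proof

Translate the integration variable by `b` (Lebesgue measure on `ℝ` is translation invariant):
with `u = t + b`, `s = (1 + iu) − ib`, so `F(1+s) = ∑ (a_n n^{ib}) n^{−(1 + (1+iu))}` and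
`x^s = x^{−ib} x^{1+iu}`; the coefficients `a_n n^{ib}` have the same norms, and the unshifted
formula applies; finally `x^{−ib} n^{ib} = (x/n)^{−ib}`.

## References

* H. L. Montgomery, R. C. Vaughan, *Multiplicative Number Theory I. Classical Theory*, CUP 2007,
  §5.1, (5.22), p. 143. [cite: MontgomeryVaughan2007]
-/

noncomputable section

open _root_.Complex Set Filter _root_.MeasureTheory

namespace Literature.Analysis.Complex

/-- For `n ≥ 1` and a purely imaginary exponent `ib`, `‖n^{ib}‖ = 1`. [folklore] -/
private theorem norm_natCast_cpow_mul_I {n : ℕ} (hn : 0 < n) (b : ℝ) : ‖(n : ℂ) ^ (b * I)‖ = 1 := by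
  rw [Complex.norm_natCast_cpow_of_pos hn]
  simp

/-- Twisting the coefficients by `n^{ib}` (`b` real) preserves the hypothesis `∑ ‖a_n‖/n² < ∞`.
[folklore] -/
private theorem summable_norm_mul_cpow_div_sq {a : ℕ → ℂ}
    (ha : Summable fun n : ℕ => ‖a n‖ / (n : ℝ) ^ 2) (b : ℝ) :
    Summable fun n : ℕ => ‖a n * (n : ℂ) ^ (b * I)‖ / (n : ℝ) ^ 2 := by
  refine ha.congr fun n => ?_
  rcases Nat.eq_zero_or_pos n with rfl | hn
  · simp
  · rw [norm_mul, norm_natCast_cpow_mul_I hn, mul_one]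

/-- The termwise identity behind the shift: for `n ≥ 1`,
`a / n^{1 + (s − ib)} = (a n^{ib}) / n^{1+s}`. [folklore] -/
private theorem div_cpow_sub_shift (a : ℂ) {n : ℕ} (hn : 0 < n) (s : ℂ) (b : ℝ) :
    a / (n : ℂ) ^ (1 + (s - b * I)) = a * (n : ℂ) ^ (b * I) / (n : ℂ) ^ (1 + s) := by
  have hn0 : (n : ℂ) ≠ 0 := by exact_mod_cast hn.ne'
  have e : (1 : ℂ) + (s - b * I) = (1 + s) + (-(b * I)) := by ring
  rw [e, Complex.cpow_add _ _ hn0, Complex.cpow_neg]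
  have hpow : (n : ℂ) ^ (b * I) ≠ 0 := Complex.cpow_ne_zero_iff.2 (Or.inl hn0)
  field_simp

/-- `(x/n)^{−ib} = x^{−ib} n^{ib}` for real `x ≥ 0` and `n ≥ 1`. [folklore] -/
private theorem ofReal_div_natCast_cpow_neg_mul_I {x : ℝ} (hx : 0 ≤ x) {n : ℕ} (hn : 0 < n) (b : ℝ) :
    (((x / n : ℝ)) : ℂ) ^ (-(b * I)) = (x : ℂ) ^ (-(b * I)) * (n : ℂ) ^ (b * I) := by
  have hn0 : (n : ℂ) ≠ 0 := by exact_mod_cast hn.ne'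
  rw [ofReal_div_natCast_cpow hx hn, Complex.cpow_neg (n : ℂ), div_eq_mul_inv, inv_inv]

/-- **Perron's formula of order two with an imaginary shift.** If `∑_n ‖a_n‖/n² < ∞`, `x > 0`
and `b ∈ ℝ`, then with `s = 1 + it`,
`∫_{−∞}^{∞} (∑_n a_n n^{−(1+s)}) x^s (s + ib)^{−2} dt = 2π ∑_{1 ≤ n ≤ x} (a_n/n)(x/n)^{−ib} log(x/n)`,
i.e. `(1/2πi)∫_(1) F(1+s) x^s ds/(s+ib)² = ∑_{n ≤ x} (a_n/n)(x/n)^{−ib} log(x/n)` for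
`F(w) = ∑ a_n n^{−w}`; both sides converge absolutely. The case `b = 0` is
`integral_dirichletSeries_mul_perronPow` with `m = 1` (Montgomery–Vaughan (5.22)); the general case
follows by the translation `t ↦ t + b` of the line of integration.
[cite: MontgomeryVaughan2007, Section 5.1 eq. 5.22] -/
theorem integral_dirichletSeries_mul_perronSq_shift {a : ℕ → ℂ}
    (ha : Summable fun n : ℕ => ‖a n‖ / (n : ℝ) ^ 2) {x : ℝ} (hx : 0 < x) (b : ℝ) :
    ∫ t : ℝ, (∑' n : ℕ, a n / (n : ℂ) ^ (1 + (((1 : ℝ) : ℂ) + t * I))) *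
        ((x : ℂ) ^ (((1 : ℝ) : ℂ) + t * I) / ((((1 : ℝ) : ℂ) + t * I) + b * I) ^ 2) =
      2 * Real.pi * ∑ n ∈ Finset.Icc 1 ⌊x⌋₊,
        a n / (n : ℂ) * ((((x / n : ℝ)) : ℂ) ^ (-(b * I)) * (Real.log (x / n) : ℂ)) := by
  have hx0 : (x : ℂ) ≠ 0 := by exact_mod_cast hx.ne'
  -- the twisted coefficients
  set a' : ℕ → ℂ := fun n => a n * (n : ℂ) ^ (b * I) with ha'def
  have ha' : Summable fun n : ℕ => ‖a' n‖ / (n : ℝ) ^ 2 := summable_norm_mul_cpow_div_sq ha b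
  -- the unshifted integrand, as a function of `u = t + b`
  set g : ℝ → ℂ := fun u => (x : ℂ) ^ (-(b * I)) *
    ((∑' n : ℕ, a' n / (n : ℂ) ^ (1 + (((1 : ℝ) : ℂ) + u * I))) *
      perronPow x 1 (((1 : ℝ) : ℂ) + u * I)) with hgdef
  -- (a) the integrand is `g (t + b)`
  have hshift : (fun t : ℝ => (∑' n : ℕ, a n / (n : ℂ) ^ (1 + (((1 : ℝ) : ℂ) + t * I))) *
      ((x : ℂ) ^ (((1 : ℝ) : ℂ) + t * I) / ((((1 : ℝ) : ℂ) + t * I) + b * I) ^ 2)) =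
      fun t => g (t + b) := by
    funext t
    have es : (((1 : ℝ) : ℂ) + t * I) = (((1 : ℝ) : ℂ) + (((t + b : ℝ)) : ℂ) * I) - b * I := by
      push_cast; ring
    have hsum : (∑' n : ℕ, a n / (n : ℂ) ^ (1 + (((1 : ℝ) : ℂ) + t * I))) =
        ∑' n : ℕ, a' n / (n : ℂ) ^ (1 + (((1 : ℝ) : ℂ) + (((t + b : ℝ)) : ℂ) * I)) := by
      refine tsum_congr fun n => ?_
      rcases Nat.eq_zero_or_pos n with rfl | hn
      · have h1 : (1 : ℂ) + (((1 : ℝ) : ℂ) + t * I) ≠ 0 := by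
          intro h; have := congrArg Complex.re h; simp at this
        have h2 : (1 : ℂ) + (((1 : ℝ) : ℂ) + (((t + b : ℝ)) : ℂ) * I) ≠ 0 := by
          intro h; have := congrArg Complex.re h; simp at this
        rw [Nat.cast_zero, Complex.zero_cpow h1, Complex.zero_cpow h2, div_zero, div_zero]
      · rw [es]
        exact div_cpow_sub_shift (a n) hn _ b
    have hpow : (x : ℂ) ^ (((1 : ℝ) : ℂ) + t * I) =
        (x : ℂ) ^ (-(b * I)) * (x : ℂ) ^ (((1 : ℝ) : ℂ) + (((t + b : ℝ)) : ℂ) * I) := by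
      rw [← Complex.cpow_add _ _ hx0]
      congr 1
      push_cast; ring
    have hden : ((((1 : ℝ) : ℂ) + t * I) + b * I) = (((1 : ℝ) : ℂ) + (((t + b : ℝ)) : ℂ) * I) := by
      push_cast; ring
    rw [hsum, hpow, hden, hgdef]
    simp only [perronPow]
    ring
  rw [hshift, integral_add_right_eq_self (μ := volume) g b]
  -- (b) the unshifted formula for the twisted coefficients
  have hmain := integral_dirichletSeries_mul_perronPow ha' hx (le_refl 1)
  rw [hgdef, MeasureTheory.integral_const_mul, hmain]
  -- (c) distribute `x^{−ib}` over the finite sum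
  rw [Finset.mul_sum, Finset.mul_sum, Finset.mul_sum]
  refine Finset.sum_congr rfl fun n hn => ?_
  obtain ⟨hn1, -⟩ := Finset.mem_Icc.1 hn
  have hn0 : 0 < n := hn1
  rw [ofReal_div_natCast_cpow_neg_mul_I hx.le hn0 b, ha'def]
  simp only [Nat.factorial_one, Nat.cast_one, div_one, pow_one]
  ring

end Literature.Analysis.Complex
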